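import Summits.NavierStokesRegularity.NavierStokesRegularity.Theorems.ScenarioCensusRowF1EventSocket
import HarnessLib

/-!
# LINE 30 «event-socket» port, part 3/4: §7 THREE INSTANCES — the axial vector `curlOf`, the SPEED / STRETCHING / CROSS-FLOW events, their scalings, physical readings,
# the three KILLS (imported by name)

Re-homed for the scenario census (typer seat ns-census-typer-1 g9; the cells F1Σth / F1Σvo / F1Ξth / F1Ξvo (+ generic F1[P]th/vo) and the floors RΣS / PΣS / RΞS /
PΞS are MEMBERS OF RECORD «DECIDED IN KERNEL IN FILES» of row F1 since census v1.92 (critic idea-crit-3 g8 PASS 06:47:48Z — no price; ref ns-census-ref g11 PRE-CHECK ✓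
§16.30 item 58; lead-presearch label item 58); this port makes them TREE-decided): VERBATIM PORT of the NEW sections (§6–§8) of ns-idea-3 LINE 30 «event-socket»,
`pub/ideators/ns-idea-3/lines/event-socket/line-event-socket.lean` sha16 6529f3492cb49b94 (1484 l., lean check rc 0, 0 sorry; its §1–§5 = LINE 27/28/29 VERBATIM,
taken BY NAME from `ScenarioCensusRowF1Socket*` / `…SharpTop*` / `…ThinTop*`), split for the 400-line rule into `ScenarioCensusRowF1EventSocket` (§6 vocabulary) →
`…EventSocketTransfer` (§6 transfer + engine) → `…EventSocketEvents` (§7) → `…EventSocketRows` (§8 + census KEYS).  Lean text VERBATIM in namespace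
`…Theorems.ScenarioCensus.EventSocket` (the line's `…Cruxes.ScenarioCensusRowF1.EventSocketLine` re-homed) with `open …LiouvilleSocket …SharpTop …ThinTop`; port
edits: `@[conjecture]` on the residuals `StretchSlack` / `CrossFlowSlack` (≡ `ScenarioCensus.Row_F1`, OPEN), one-line docstrings added where missing (gate lint); `cross_smul_smul` is the tree's `UnthreadedRigidity.ThreadingJets.cross_smul_smul` taken BY NAME (review p713151).
Statements untouched.

No census VALUE is moved here (row F1 stays OPEN-WITH-LINE; the members become TREE-decided by name); NS regularity is NOT proved; `Row_F1` is untouched (zero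
movement, `evSlack_iff_rowF1` / `stretchSlack_iff_rowF1` / `crossFlowSlack_iff_rowF1`); no summit statement is proved by this file. Lemmas that restate already-landed tree declarations are taken BY NAME (gate lint `dedup.landed`): `fderiv_smul_stPull_apply` = `InviscidTop.fderiv_smul_stPull_apply`, `fderiv_smul_stPull` = `InviscidTop.fderiv_smul_stPull`, `fderiv_fderiv_smul_stPull` = `InviscidTop.fderiv_fderiv_smul_stPull`, `tendsto_clm_of_tendsto_apply` = `InviscidTop.tendsto_clm_of_tendsto_apply`, `tendsto_fderiv_fderiv_apply_of_bound` = `InviscidTop.tendsto_fderiv_fderiv_apply_of_bound`, `tendsto_fderiv_fderiv_of_bound` = `InviscidTop.tendsto_fderiv_fderiv_of_bound`, `tendsto_fderiv_fderiv_of_typeI_seq_Ioo` = `InviscidTop.tendsto_fderiv_fderiv_of_typeI_seq_Ioo`, `fderiv3_smul_stPull` = `FrozenTop.fderiv3_smul_stPull`, `tendsto_fderiv3_of_typeI_seq_Ioo` = `FrozenTop.tendsto_fderiv3_of_typeI_seq_Ioo`, `tendsto_physicalTime` = `ColumnarTop.tendsto_physicalTime`, `eventually_fast` = `ColumnarTop.eventually_fast`,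 `sqrt_timeLag` = `StretchedTop.sqrt_timeLag`, `forall_of_forall_ne_zero` = `StretchedTop.forall_of_forall_ne_zero`, `radius_eq` = `FrozenTop.radius_eq`, `jointCond_everywhere₆` = `FrozenTop.jointCond_everywhere₄`, `continuousOn_quad` = `IntegratedStretch.continuousOn_quad`, `sqrt_nu_timeLag` = `IntegratedStretch.sqrt_nu_timeLag`, `sing_of_not_bounded` = `InviscidTop.sing_of_not_bounded`, `exists_singularZoom_package₃` = `FrozenTop.exists_singularZoom_package₃`, `lapD_eq_zero_of_eq_zero` = `FrozenTop.lapD_eq_zero_of_eq_zero`, `measurableSet_top` = `IntegratedStretch.measurableSet_top`, `cross_smul_smul` = `UnthreadedRigidity.ThreadingJets.cross_smul_smul`.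
-/

-- the summit and its single problem share the name `NavierStokesRegularity` (D-0017 nested layout)
set_option linter.dupNamespace false

noncomputable section

open MeasureTheory Set Function Filter TopologicalSpace Metric
open scoped Topology NNReal ENNReal InnerProductSpace RealInnerProductSpace Laplacian

namespace Summit.NavierStokesRegularity.NavierStokesRegularity.Theorems.ScenarioCensus.EventSocket

open Literature.Analysis Literature.Analysis.FluidPDE
open Summit.NavierStokesRegularity.NavierStokesRegularity.Theorems
open Summit.NavierStokesRegularity.NavierStokesRegularity.Theorems.ScenarioCensus.LiouvilleSocket
open Summit.NavierStokesRegularity.NavierStokesRegularity.Theorems.ScenarioCensus.SharpTop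
open Summit.NavierStokesRegularity.NavierStokesRegularity.Theorems.ScenarioCensus.ThinTop

/-! ## §7 THREE INSTANCES: the SPEED event (recovers LINE 29's apex row), the STRETCHING event and the CROSS-FLOW event
(both NEW on the volume axis) — kills imported BY NAME from the tree -/

/-! ### The axial vector of a matrix (so that `curl v x = curlOf (∇v(x))` definitionally) -/

/-- The axial vector of a `3 × 3` matrix `A` (the components `(A₁₂' − A₂₁', …)` of the tree's `curl`, with `A` in place of
`∇v(x)`): `curl v x = curlOf (fderiv ℝ v x)` holds by `rfl` (`curl_eq_curlOf`). -/
def curlOf (A : E3 →L[ℝ] E3) : E3 :=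
  let D : Fin 3 → Fin 3 → ℝ := fun j i => A (EuclideanSpace.single j 1) i
  WithLp.toLp 2 ![D 1 2 - D 2 1, D 2 0 - D 0 2, D 0 1 - D 1 0]

/-- The tree's `curl` is the axial vector of the gradient (definitional). -/
theorem curl_eq_curlOf (v : E3 → E3) (x : E3) : curl v x = curlOf (fderiv ℝ v x) := rfl

/-- Component `0` of the axial vector. -/
theorem curlOf_apply_zero (A : E3 →L[ℝ] E3) :
    curlOf A 0 = A (EuclideanSpace.single 1 1) 2 - A (EuclideanSpace.single 2 1) 1 := rfl

/-- Component `1` of the axial vector. -/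
theorem curlOf_apply_one (A : E3 →L[ℝ] E3) :
    curlOf A 1 = A (EuclideanSpace.single 2 1) 0 - A (EuclideanSpace.single 0 1) 2 := rfl

/-- Component `2` of the axial vector. -/
theorem curlOf_apply_two (A : E3 →L[ℝ] E3) :
    curlOf A 2 = A (EuclideanSpace.single 0 1) 1 - A (EuclideanSpace.single 1 1) 0 := rfl

/-- `curlOf` is additive. -/
theorem curlOf_add (A B : E3 →L[ℝ] E3) : curlOf (A + B) = curlOf A + curlOf B := by
  ext i
  fin_cases i
  · simp only [PiLp.add_apply, Fin.zero_eta, curlOf_apply_zero, FunLike.coe_add, Pi.add_apply]; ring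
  · simp only [PiLp.add_apply, Fin.mk_one, curlOf_apply_one, FunLike.coe_add, Pi.add_apply]; ring
  · simp only [PiLp.add_apply, Fin.reduceFinMk, curlOf_apply_two, FunLike.coe_add, Pi.add_apply]; ring

/-- `curlOf` is homogeneous: `curlOf (a A) = a · curlOf A`. -/
theorem curlOf_smul (a : ℝ) (A : E3 →L[ℝ] E3) : curlOf (a • A) = a • curlOf A := by
  ext i
  fin_cases i
  · simp only [PiLp.smul_apply, Fin.zero_eta, curlOf_apply_zero, FunLike.coe_smul, Pi.smul_apply, smul_eq_mul]; ring
  · simp only [PiLp.smul_apply, Fin.mk_one, curlOf_apply_one, FunLike.coe_smul, Pi.smul_apply, smul_eq_mul]; ring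
  · simp only [PiLp.smul_apply, Fin.reduceFinMk, curlOf_apply_two, FunLike.coe_smul, Pi.smul_apply, smul_eq_mul]; ring

/-- `curlOf` as a linear map (used only for its automatic continuity in finite dimension). -/
def curlOfₗ : (E3 →L[ℝ] E3) →ₗ[ℝ] E3 where
  toFun := curlOf
  map_add' := curlOf_add
  map_smul' := curlOf_smul

/-- The axial vector depends continuously on the matrix. -/
theorem continuous_curlOf : Continuous curlOf :=
  (curlOfₗ.continuous_of_finiteDimensional : Continuous curlOfₗ)

-- `cross_smul_smul`: the line restates the tree's `UnthreadedRigidity.ThreadingJets.cross_smul_smul`; taken BY NAME (gate lint dedup.landed).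

/-! ### The three events -/

/-- **The SPEED event** `𝒮_κ = {(V, A) : κ < ‖V‖²}`: physically `κν/(T − t) < ‖u(t,x)‖²` (LINE 29's `κ`-fast slice,
`mem_eventSlice_speedEv_iff`); on the ancient side `κ < (−s)‖W(s,y)‖²`. -/
def SpeedEv (κ : ℝ) : Set Jet := {J | κ < ‖J.1‖ ^ 2}

/-- **The STRETCHING event** `Σ_θ = {(V, A) : θ‖ω_A‖² < ⟪A ω_A, ω_A⟫}` (`ω_A = curlOf A`): physically
`θ‖ω(t,x)‖² < (T − t) ⟪∇u(t,x) ω(t,x), ω(t,x)⟫` — the VORTEX-STRETCHING RATE along the vorticity exceeds `θ/(T − t)`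
(`mem_eventSlice_stretchEv_iff`; `ν`-free); on the ancient side `θ‖ω‖² < (−s)⟪∇W ω, ω⟫`. -/
def StretchEv (θ : ℝ) : Set Jet := {J | θ * ‖curlOf J.2‖ ^ 2 < ⟪J.2 (curlOf J.2), curlOf J.2⟫_ℝ}

/-- **The CROSS-FLOW event** `𝒳_θ = {(V, A) : θ‖ω_A‖ < ‖ω_A × V‖}`: physically
`θ‖ω(t,x)‖ < √((T − t)/ν) ‖ω(t,x) × u(t,x)‖` — the LAMB VECTOR is super-critical relative to the vorticity
(`mem_eventSlice_crossEv_iff`); on the ancient side `θ‖ω‖ < √(−s)‖ω × W‖`. -/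
def CrossEv (θ : ℝ) : Set Jet := {J | θ * ‖curlOf J.2‖ < ‖cross (curlOf J.2) J.1‖}

/-- The three events are ANTITONE in their parameter (so each family of rows is MONOTONE and each family of floors
ANTITONE in `θ`, `κ` — `evRow_anti`). -/
theorem speedEv_anti {κ₁ κ₂ : ℝ} (h : κ₁ ≤ κ₂) : SpeedEv κ₂ ⊆ SpeedEv κ₁ :=
  fun _ hJ => lt_of_le_of_lt h hJ

/-- The stretching event is antitone in its threshold. -/
theorem stretchEv_anti {θ₁ θ₂ : ℝ} (h : θ₁ ≤ θ₂) : StretchEv θ₂ ⊆ StretchEv θ₁ :=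
  fun _ hJ => lt_of_le_of_lt (mul_le_mul_of_nonneg_right h (sq_nonneg _)) hJ

/-- The cross-flow event is antitone in its threshold. -/
theorem crossEv_anti {θ₁ θ₂ : ℝ} (h : θ₁ ≤ θ₂) : CrossEv θ₂ ⊆ CrossEv θ₁ :=
  fun _ hJ => lt_of_le_of_lt (mul_le_mul_of_nonneg_right h (norm_nonneg _)) hJ

/-- The speed event is open. -/
theorem isOpen_speedEv (κ : ℝ) : IsOpen (SpeedEv κ) :=
  isOpen_lt continuous_const ((continuous_fst.norm).pow 2)

/-- The stretching event is open. -/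
theorem isOpen_stretchEv (θ : ℝ) : IsOpen (StretchEv θ) := by
  have hc : Continuous fun J : Jet => curlOf J.2 := continuous_curlOf.comp continuous_snd
  exact isOpen_lt (continuous_const.mul ((hc.norm).pow 2)) ((continuous_snd.clm_apply hc).inner hc)

/-- The cross-flow event is open. -/
theorem isOpen_crossEv (θ : ℝ) : IsOpen (CrossEv θ) := by
  have hc : Continuous fun J : Jet => curlOf J.2 := continuous_curlOf.comp continuous_snd
  have hx : Continuous fun J : Jet => ‖cross (curlOf J.2) J.1‖ := by
    have h := ((crossCLM.continuous.comp hc).clm_apply continuous_fst).norm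
    simpa only [Function.comp, crossCLM_apply] using h
  exact isOpen_lt (continuous_const.mul hc.norm) hx

/-! ### How the events read under scalings (one computation serves the physical reading AND the ancient kill) -/

/-- How the speed event reads under scalings. -/
theorem mem_speedEv_smul_iff {κ b : ℝ} (hb : 0 ≤ b) (V : E3) (A : E3 →L[ℝ] E3) :
    ((b • V, A) : Jet) ∈ SpeedEv κ ↔ κ < b ^ 2 * ‖V‖ ^ 2 := by
  simp only [SpeedEv, mem_setOf_eq, norm_smul, Real.norm_eq_abs, abs_of_nonneg hb, mul_pow]

/-- How the stretching event reads under scalings. -/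
theorem mem_stretchEv_smul_iff {θ a : ℝ} (ha : 0 < a) (V : E3) (A : E3 →L[ℝ] E3) :
    ((V, a • A) : Jet) ∈ StretchEv θ ↔ θ * ‖curlOf A‖ ^ 2 < a * ⟪A (curlOf A), curlOf A⟫_ℝ := by
  simp only [StretchEv, mem_setOf_eq, curlOf_smul, FunLike.coe_smul, Pi.smul_apply, map_smul, real_inner_smul_left,
    real_inner_smul_right, norm_smul, Real.norm_eq_abs, abs_of_pos ha, mul_pow]
  have ha2 : 0 < a ^ 2 := pow_pos ha 2
  constructor
  · intro h; nlinarith [h, ha2]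
  · intro h; nlinarith [h, ha2]

/-- How the cross-flow event reads under scalings. -/
theorem mem_crossEv_smul_iff {θ a b : ℝ} (ha : 0 < a) (hb : 0 ≤ b) (V : E3) (A : E3 →L[ℝ] E3) :
    ((b • V, a • A) : Jet) ∈ CrossEv θ ↔ θ * ‖curlOf A‖ < b * ‖cross (curlOf A) V‖ := by
  simp only [CrossEv, mem_setOf_eq, curlOf_smul, UnthreadedRigidity.ThreadingJets.cross_smul_smul, norm_smul, Real.norm_eq_abs, abs_of_pos ha,
    abs_of_nonneg (mul_nonneg ha.le hb)]
  constructor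
  · intro h; nlinarith [h, ha, norm_nonneg (cross (curlOf A) V), norm_nonneg (curlOf A)]
  · intro h; nlinarith [h, ha, norm_nonneg (cross (curlOf A) V), norm_nonneg (curlOf A)]

/-! ### Physical readings of the three event slices -/

/-- The speed-event slice is LINE 29's `κ`-fast slice `{κν/(T − t) < ‖u(t,x)‖²}`. -/
theorem mem_eventSlice_speedEv_iff {T ν κ t : ℝ} (hν : 0 < ν) (ht : t < T) (u : ℝ → E3 → E3) (x : E3) :
    x ∈ eventSlice (SpeedEv κ) T ν u t ↔ κ * (ν * (T - t)⁻¹) < ‖u t x‖ ^ 2 := by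
  have hL : 0 < (T - t) / ν := div_pos (sub_pos.2 ht) hν
  rw [eventSlice, mem_setOf_eq, physJet, mem_speedEv_smul_iff (Real.sqrt_nonneg _), Real.sq_sqrt hL.le,
    show κ * (ν * (T - t)⁻¹) = κ / ((T - t) / ν) by field_simp, div_lt_iff₀ hL, mul_comm]

/-- The stretching-event slice: `θ‖ω‖² < (T − t)⟪∇u ω, ω⟫` at `(t, x)` (`ω = curl u(t) x`; independent of `ν`). -/
theorem mem_eventSlice_stretchEv_iff {T ν θ t : ℝ} (ht : t < T) (u : ℝ → E3 → E3) (x : E3) :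
    x ∈ eventSlice (StretchEv θ) T ν u t ↔
      θ * ‖curl (u t) x‖ ^ 2 < (T - t) * ⟪fderiv ℝ (u t) x (curl (u t) x), curl (u t) x⟫_ℝ := by
  rw [eventSlice, mem_setOf_eq, physJet, mem_stretchEv_smul_iff (sub_pos.2 ht), ← curl_eq_curlOf]

/-- The cross-flow-event slice: `θ‖ω‖ < √((T − t)/ν) ‖ω × u‖` at `(t, x)`. -/
theorem mem_eventSlice_crossEv_iff {T ν θ t : ℝ} (ht : t < T) (u : ℝ → E3 → E3) (x : E3) :
    x ∈ eventSlice (CrossEv θ) T ν u t ↔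
      θ * ‖curl (u t) x‖ < Real.sqrt ((T - t) / ν) * ‖cross (curl (u t) x) (u t x)‖ := by
  rw [eventSlice, mem_setOf_eq, physJet, mem_crossEv_smul_iff (sub_pos.2 ht) (Real.sqrt_nonneg _), ← curl_eq_curlOf]

/-! ### The three KILLS, imported by name -/

/-- **The speed event kills** for `κ < 1`: the tree's time-constant threshold
`SimilarityEnstrophy.typeI_ancient_eq_zero_of_timeConstant_lt_one_noDecay` (through `ThinTop.slow_ancient_trivial`). -/
theorem eventKills_speedEv {κ : ℝ} (hκ : κ < 1) : EventKills (SpeedEv κ) := by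
  intro M W hW hno
  refine ThinTop.slow_ancient_trivial hκ hW fun s hs y => ?_
  have h := hno s hs y
  rw [ancientJet, mem_speedEv_smul_iff (Real.sqrt_nonneg _), Real.sq_sqrt (neg_pos.2 hs).le, not_lt] at h
  exact h

/-- **The stretching event kills** for `θ < 1`: the tree's SUB-CRITICAL STRETCHING LIOUVILLE theorem
`StretchedTop.typeI_ancient_eq_zero_of_subcriticalStretching` (`(−s)⟪∇W ω, ω⟫ ≤ θ‖ω‖²` everywhere ⇒ `W ≡ 0`). -/
theorem eventKills_stretchEv {θ : ℝ} (hθ : θ < 1) : EventKills (StretchEv θ) := by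
  intro M W hW hno
  refine ScenarioCensus.StretchedTop.typeI_ancient_eq_zero_of_subcriticalStretching hθ hW fun s hs y => ?_
  have h := hno s hs y
  rw [ancientJet, mem_stretchEv_smul_iff (neg_pos.2 hs), ← curl_eq_curlOf, not_lt] at h
  exact h

/-- **The cross-flow event kills** for `θ < 1`: the tree's CROSS-FLOW Liouville theorem
`SimilarityEnstrophy.typeI_ancient_eq_zero_of_crossFlow_lt_one_noDecay` (`√(−s)‖ω × W‖ ≤ θ‖ω‖` everywhere ⇒ `W ≡ 0`). -/
theorem eventKills_crossEv {θ : ℝ} (hθ : θ < 1) : EventKills (CrossEv θ) := by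
  intro M W hW hno
  refine SimilarityEnstrophy.typeI_ancient_eq_zero_of_crossFlow_lt_one_noDecay hW hθ fun s hs y => ?_
  have h := hno s hs y
  rw [ancientJet, mem_crossEv_smul_iff (neg_pos.2 hs) (Real.sqrt_nonneg _), ← curl_eq_curlOf, not_lt] at h
  exact h

end Summit.NavierStokesRegularity.NavierStokesRegularity.Theorems.ScenarioCensus.EventSocket

end
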